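import Summits.ResolutionOfSingularities.ResolutionOfSingularities.Theorems.WildQuotientsGaloisReduction
import Summits.ResolutionOfSingularities.ResolutionOfSingularities.Theorems.WildQuotientsGaloisQuotientAlteration
import HarnessLib

/-!
# `WildQuotients.GaloisReduction` (stmt-ResolutionOfSingularities-15641) from de Jong's theorem

Route `ResolutionOfSingularities/WildQuotients`, support item `GaloisReduction`
(`:= WildQuotientResolution → Pialt`): de Jong's REDUCTION of the Abramovich–Oort purely
inseparable regular alteration (`Pialt`) to the resolution of Galois-type quotients `X′/G` of
regular varieties (`WildQuotientResolution`).

Everything is now in tree except de Jong's theorem itself: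

* `Theorems.galoisQuotientAlteration_of_deJong1997` (`…WildQuotientsGaloisQuotientAlteration`):
  the existential half `GaloisQuotientAlteration` — de Jong's Galois alteration `π : X′ → X`
  (regular quasi-projective source, faithful finite group `G`, `K(X) ⊂ K(X′)^G` purely
  inseparable), its scheme quotient `q : X′ → X₁ = X′/G` (finite, surjective, generically étale,
  fibres the orbits) and `φ : X₁ → X` (proper, surjective, finite and radicial over a dense open)
  — CONDITIONAL on the named fact
  `Literature.AlgebraicGeometry.Resolution.DeJong1997_galoisAlterationQuasiProjective`
  (de Jong 1997, Thm. 5.13 / Cor. 5.15; de Jong 1996, Thm. 7.3; Abramovich–Oort 2000, Thm. 2.8);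
* `Theorems.galoisReduction_of_galoisQuotientAlteration` (`…WildQuotientsGaloisReduction`,
  p127698): the compositional half — resolve `X₁` by `WildQuotientResolution` and compose with
  `φ` (purely inseparable alterations compose, de Jong 1996, 2.20).

Hence:

* `galoisReduction_of_deJong1997 : DeJong1997_galoisAlterationQuasiProjective → GaloisReduction`
  — the item, conditional on de Jong's theorem only;
* `pialtAt_of_deJong1997` — at a fixed prime `p`: `WQ_p → PIAlt_p` (the bodies of
  `WildQuotientResolution` and `Pialt` at `p`, verbatim), the form consumed by the crux
  `SummitReduction` (stmt-ResolutionOfSingularities-16324) together with pAlteration's proved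
  frame `Theorems.hasResolution_of_thesis p`.
-/

-- single-problem summit: the doubled namespace component `ResolutionOfSingularities` is forced
set_option linter.dupNamespace false

noncomputable section

open CategoryTheory AlgebraicGeometry

namespace Summit.ResolutionOfSingularities.ResolutionOfSingularities.Theorems

open Literature.AlgebraicGeometry.Resolution

/-- **`GaloisReduction` (stmt-ResolutionOfSingularities-15641) from de Jong's theorem**:
`WildQuotientResolution → Pialt`, i.e. resolution of the Galois-type quotients `X′/G` of regular
varieties implies the Abramovich–Oort purely inseparable regular alteration of every variety —
de Jong's reduction (de Jong 1997, Thm. 5.13 / Cor. 5.15): take the Galois alteration and its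
quotient (`galoisQuotientAlteration_of_deJong1997`), resolve the quotient, compose
(`galoisReduction_of_galoisQuotientAlteration`). CONDITIONAL on the named fact
`DeJong1997_galoisAlterationQuasiProjective` (de Jong's theorem) only.
[cite: DeJong1997, Thm. 5.13, Cor. 5.15, pp. 619–620] [cite: DeJong1996, 2.20] -/
theorem galoisReduction_of_deJong1997 (hdJ : DeJong1997_galoisAlterationQuasiProjective.{0}) :
    Theses.WildQuotients.GaloisReduction :=
  galoisReduction_of_galoisQuotientAlteration (galoisQuotientAlteration_of_deJong1997 hdJ)

/-- **At a fixed prime `p`: `WQ_p → PIAlt_p` from de Jong's theorem** — the body of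
`WildQuotientResolution` at `p` implies the body of `Pialt` at `p`: feed
`pialtAt_of_galoisQuotientAlterationAt` with the Galois quotient alteration at `p`
(`galoisQuotientAlteration_of_deJong1997`). Steps (1)+(2) of the crux `SummitReduction`; its
prover finishes with pAlteration's proved per-prime frame `Theorems.hasResolution_of_thesis p`
and `PAlteration.DescentReducedToIntegral_holds`. CONDITIONAL on
`DeJong1997_galoisAlterationQuasiProjective`. [cite: DeJong1997, Cor. 5.15] -/
theorem pialtAt_of_deJong1997 (hdJ : DeJong1997_galoisAlterationQuasiProjective.{0}) {p : ℕ}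
    (hp : p.Prime)
    (hWQ : ∀ (k : Type) [Field k] [CharP k p] (X' X₁ : Scheme.{0}) (f : X₁ ⟶ Spec (.of k))
      (q : X' ⟶ X₁) (G : Type) [Group G] [Finite G] (ρ : G →* Aut X'),
      IsSeparated f → LocallyOfFiniteType f → QuasiCompact f → IsIntegral X₁ → IsIntegral X' →
      Scheme.IsRegular X' → IsFinite q → Function.Surjective q.base →
      (∃ U : X₁.Opens, Dense (U : Set X₁) ∧ Etale (q ∣_ U)) → (∀ g : G, (ρ g).hom ≫ q = q) →
      (∀ x y : X', q.base x = q.base y → ∃ g : G, (ρ g).hom.base x = y) →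
      Scheme.HasResolution X₁)
    (k : Type) [Field k] [CharP k p] (X : Scheme.{0}) (f : X ⟶ Spec (.of k)) (hs : IsSeparated f)
    (hl : LocallyOfFiniteType f) (hc : QuasiCompact f) (hi : IsIntegral X) :
    ∃ (X' : Scheme.{0}) (g : X' ⟶ X), IsProper g ∧ IsIntegral X' ∧ Scheme.IsRegular X' ∧
      Function.Surjective g.base ∧
      ∃ U : X.Opens, Dense (U : Set X) ∧ IsFinite (g ∣_ U) ∧ UniversallyInjective (g ∣_ U) :=
  pialtAt_of_galoisQuotientAlterationAt (p := p)
    (fun k _ _ X f hs hl hc hi => galoisQuotientAlteration_of_deJong1997 hdJ p hp k X f hs hl hc hi)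
    hWQ k X f hs hl hc hi

end Summit.ResolutionOfSingularities.ResolutionOfSingularities.Theorems

end
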